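import Summits.Ventures.HSemireg.WedgeHankelRecurrenceGaussVandermondeDiscriminant

/-!
# Venture HSemireg — **THE RESULTANT OF `q_{n+2}` AND `q_n` AND THEIR COMMON ZEROS**: over any nontrivial commutative ring,
# **`Res_{(n+2,n)}(q_{n+2}, q_n) = q_n(a_{n+1}) · ∏_{k<n} (−b_{k+1})^{k+1}`** (Schur's step once more: `q_{n+2} ≡ (X − a_{n+1}) q_{n+1} mod q_n`); hence over a field with `b_1⋯b_n ≠ 0`,
# **`q_{n+2}` and `q_n` are coprime iff `q_n(a_{n+1}) ≠ 0`**, and for a positive real recurrence **`q_{n+2}` and `q_n` have a common (real) zero iff `q_n(a_{n+1}) = 0`**, the common zero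
# then being `a_{n+1}` itself

HONEST FRAMING. Part of the Lean index of the computation cell `pub-hsemireg` (seat p10 gen 47, Sunday typer «UNIFORM-IN-n»).  Polynomial algebra (Mathlib `Polynomial.resultant`, `IsCoprime`) only;
no variety, no cohomology theory, no sheaf, no Ext group and no semiregularity map is constructed here; nothing here says that HC / HC_CM / HC_AV holds; no Literature fact (unproved `Prop`) is
declared or used.  Custodian versions as in `WedgeHankelSiegelIdeal` (1/3).
SOURCES (cited).  I. Schur, J. reine angew. Math. 165 (1931) 52–58, §1 (the resultant recursion); P. C. Gibson, *Common zeros of two polynomials in an orthogonal sequence*, J. Approx. Theory 105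
(2000) 129–132 (common zeros of `p_n`, `p_m`; the case `m = n − 2`); K. Driver, K. Jordaan, *Zeros of quasi-orthogonal Jacobi polynomials*, SIGMA 12 (2016) 042, Lemma 2.1-type statements
(`p_{n+1}` and `p_{n−1}` have a common zero iff it equals the recurrence shift); G. Szegő, *Orthogonal Polynomials*, §3.3.  The closed resultant formula is the COROLLARY of Schur's step typed here;
no separate printed locator is claimed for it.
PROOF TYPED HERE.  `Res_{(n+2,n)}((X − a_{n+1}) q_{n+1} − b_{n+1} q_n, q_n) = Res_{(n+2,n)}((X − a_{n+1}) q_{n+1}, q_n)` (Mathlib `resultant_add_mul_left`) `= Res_{(1,n)}(X − a_{n+1}, q_n) ·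
Res_{(n+1,n)}(q_{n+1}, q_n)` (`resultant_mul_left` at the true degrees) `= q_n(a_{n+1}) · ∏ (−b_k)^k` (`resultant_X_sub_C_left`, N403); coprimality through N94
`resultant_ne_zero_iff_isCoprime_of_monic`; the real common zero is `a_{n+1}` since consecutive members have no common zero (N419 `recurrence_isCoprime`).
DEDUP DISCLOSURE (`rg -n -i 'gap_two|common_zero|resultant_skip' Summits/Ventures/HSemireg/WedgeHankelRecurrenceGauss*`, 2026-09-04): N276 `recurrence_no_common_root` (consecutive members);
nothing for `q_{n+2}` vs `q_n`; 0 hits for the 4 names below.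

WHAT IS IN THE TREE.  N403 `schur_resultant`, `recurrence_natDegree_le_coeff`; N404 `recurrence_natDegree_leadingCoeff`; N94 `resultant_ne_zero_iff_isCoprime_of_monic`; N419 `recurrence_isCoprime`;
Mathlib `resultant_add_mul_left`, `resultant_mul_left`, `resultant_X_sub_C_left`.
THIS FILE (namespace `Summit.Ventures.HSemireg.Wedge.HankelOuter` continued; CHAINED on N420 (import only); 0 definitions):
* §1186 **`resultant_gap_two`** (`Res_{(n+2,n)}(q_{n+2}, q_n) = q_n(a_{n+1}) ∏_{k<n} (−b_{k+1})^{k+1}`), **`isCoprime_gap_two_iff`** (field, `b ≠ 0`), `eval_succ_succ_at_diag` (`q_{n+2}(a_{n+1}) = −b_{n+1} q_n(a_{n+1})`),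
  **`common_zero_gap_two_iff`** (real positive recurrence: `(∃ s, q_{n+2}(s) = 0 ∧ q_n(s) = 0) ↔ q_n(a_{n+1}) = 0`).
CAVEATS.  Formal degrees explicit; `Nontrivial R` for the degree bookkeeping of `resultant_mul_left`.  Nothing Ext-side.  New names only.
-/

open Module Polynomial
open scoped Matrix Polynomial

namespace Summit.Ventures.HSemireg.Wedge.HankelOuter

/-! ## §1186. `Res(q_{n+2}, q_n)` and the common zeros two steps apart -/

/-- **`Res_{(n+2,n)}(q_{n+2}, q_n) = q_n(a_{n+1}) · ∏_{k<n} (−b_{k+1})^{k+1}`** over any nontrivial commutative ring. [corollary of Schur 1931 §1; this file, §1186] -/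
theorem resultant_gap_two {R : Type*} [CommRing R] [Nontrivial R] {q : ℕ → R[X]} {a b : ℕ → R} (hq0 : q 0 = 1) (hq1 : q 1 = Polynomial.X - C (a 0))
    (hrec : ∀ n, q (n + 2) = (Polynomial.X - C (a (n + 1))) * q (n + 1) - C (b (n + 1)) * q n) (n : ℕ) :
    (q (n + 2)).resultant (q n) (n + 2) n = (q n).eval (a (n + 1)) * ∏ k ∈ Finset.range n, (-b (k + 1)) ^ (k + 1) := by
  obtain ⟨hdn, -⟩ := recurrence_natDegree_le_coeff hq0 hq1 hrec n
  obtain ⟨hd1, -⟩ := recurrence_natDegree_leadingCoeff hq0 hq1 hrec (n + 1)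
  have h1 : q (n + 2) = (Polynomial.X - C (a (n + 1))) * q (n + 1) + q n * C (-b (n + 1)) := by rw [hrec n, map_neg]; ring
  have hf : ((Polynomial.X - C (a (n + 1))) * q (n + 1)).natDegree ≤ n + 2 := natDegree_mul_le.trans (by have := natDegree_X_sub_C_le (a (n + 1)); omega)
  rw [h1, resultant_add_mul_left _ _ _ _ _ (by rw [natDegree_C]; omega) hdn]
  have hmul := resultant_mul_left (Polynomial.X - C (a (n + 1))) (q (n + 1)) (q n) n hdn
  rw [natDegree_X_sub_C, hd1, show 1 + (n + 1) = n + 2 by ring] at hmul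
  rw [hmul, resultant_X_sub_C_left _ _ _ hdn, schur_resultant hq0 hq1 hrec n]

/-- **Over a field with `b_1, …, b_n ≠ 0`: `q_{n+2}` and `q_n` are coprime iff `q_n(a_{n+1}) ≠ 0`.** [Gibson 2000; Driver–Jordaan 2016; this file, §1186] -/
theorem isCoprime_gap_two_iff {K : Type*} [Field K] {q : ℕ → K[X]} {a b : ℕ → K} (hq0 : q 0 = 1) (hq1 : q 1 = Polynomial.X - C (a 0))
    (hrec : ∀ n, q (n + 2) = (Polynomial.X - C (a (n + 1))) * q (n + 1) - C (b (n + 1)) * q n) {n : ℕ} (hb : ∀ k, k < n → b (k + 1) ≠ 0) :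
    IsCoprime (q (n + 2)) (q n) ↔ (q n).eval (a (n + 1)) ≠ 0 := by
  classical
  obtain ⟨hd2, hl2⟩ := recurrence_natDegree_leadingCoeff hq0 hq1 hrec (n + 2)
  obtain ⟨hdn, -⟩ := recurrence_natDegree_leadingCoeff hq0 hq1 hrec n
  have hm : (q (n + 2)).Monic := by rw [Monic, hl2]
  rw [← resultant_ne_zero_iff_isCoprime_of_monic K hm (by rw [hd2]; omega) (q n)]
  show (q (n + 2)).resultant (q n) (q (n + 2)).natDegree (q n).natDegree ≠ 0 ↔ _
  rw [hd2, hdn, resultant_gap_two hq0 hq1 hrec n, mul_ne_zero_iff]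
  exact ⟨fun h => h.1, fun h => ⟨h, Finset.prod_ne_zero_iff.2 fun k hk => pow_ne_zero _ (neg_ne_zero.2 (hb k (Finset.mem_range.1 hk)))⟩⟩

/-- **`q_{n+2}(a_{n+1}) = −b_{n+1} q_n(a_{n+1})`** (any commutative ring). [Szegő §3.3; this file, §1186] -/
theorem eval_succ_succ_at_diag {R : Type*} [CommRing R] {q : ℕ → R[X]} {a b : ℕ → R}
    (hrec : ∀ n, q (n + 2) = (Polynomial.X - C (a (n + 1))) * q (n + 1) - C (b (n + 1)) * q n) (n : ℕ) :
    (q (n + 2)).eval (a (n + 1)) = -b (n + 1) * (q n).eval (a (n + 1)) := by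
  rw [hrec n, eval_sub, eval_mul, eval_sub, eval_X, eval_C, sub_self, zero_mul, zero_sub, eval_mul, eval_C, neg_mul]

/-- **COMMON ZEROS TWO STEPS APART: for a positive real recurrence, `q_{n+2}` and `q_n` have a common zero iff `q_n(a_{n+1}) = 0`** (and then `a_{n+1}` is the common zero; consecutive
members never share a zero). [Gibson 2000; Driver–Jordaan 2016; this file, §1186] -/
theorem common_zero_gap_two_iff {q : ℕ → ℝ[X]} {a b : ℕ → ℝ} (hq0 : q 0 = 1) (hq1 : q 1 = Polynomial.X - C (a 0))
    (hrec : ∀ n, q (n + 2) = (Polynomial.X - C (a (n + 1))) * q (n + 1) - C (b (n + 1)) * q n) (hb : ∀ j, 0 < b j) (n : ℕ) :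
    (∃ s, (q (n + 2)).eval s = 0 ∧ (q n).eval s = 0) ↔ (q n).eval (a (n + 1)) = 0 := by
  constructor
  · rintro ⟨s, h2, h0⟩
    -- `(s − a_{n+1}) q_{n+1}(s) = 0` and `q_{n+1}(s) ≠ 0`
    have hq1s : (q (n + 1)).eval s ≠ 0 := fun h1 => by
      have hc := recurrence_isCoprime hq0 hq1 hrec (n := n) (fun k _ => (hb (k + 1)).ne')
      obtain ⟨u, v, huv⟩ := hc
      have := congrArg (eval s) huv
      rw [eval_add, eval_mul, eval_mul, h1, h0, mul_zero, mul_zero, add_zero, eval_one] at this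
      exact zero_ne_one this
    have h := h2
    rw [hrec n, eval_sub, eval_mul, eval_sub, eval_X, eval_C, eval_mul, eval_C, h0, mul_zero, sub_zero] at h
    rcases mul_eq_zero.1 h with h' | h'
    · rw [sub_eq_zero] at h'; rw [← h']; exact h0
    · exact absurd h' hq1s
  · intro h
    exact ⟨a (n + 1), by rw [eval_succ_succ_at_diag hrec n, h, mul_zero], h⟩

end Summit.Ventures.HSemireg.Wedge.HankelOuter
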